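import Literature.MathematicalPhysics.QuantumLattice.JordanWignerEmbeddingUpper
import Literature.MathematicalPhysics.QuantumLattice.SpinPartialTrace
import Literature.InformationTheory.Entropy.ConditionalEntropyConcavity
import HarnessLib

/-!
# The partial trace (reduced density matrix) of a lattice fermion system along a site injection,
# and its Jordan–Wigner dictionary with the spin-system partial trace

Topic `MathematicalPhysics/QuantumLattice`, namespace `Literature.MathematicalPhysics.QuantumLattice`.

For finite linearly ordered site types `Λ, Λ'` and an injection of sites `φ : Λ ↪ Λ'`, the tree has the
second quantisation `Γ_φ = fermionEmbed φ : 𝔄^{CAR}_Λ →ₐ 𝔄^{CAR}_{Λ'}` (`c_{xσ} ↦ c_{φx,σ}`; isotony / covariance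
map of the local CAR algebras, Araki–Moriya §4.1) on the Jordan–Wigner = Fock matrices
`Matrix (𝒫(Orb Λ)) (𝒫(Orb Λ)) ℂ`. This file adds its Hilbert–Schmidt adjoint on DENSITY MATRICES, the
**fermionic partial trace**

  `fermionPartialTrace φ : Matrix (𝒫(Orb Λ')) →ₗ Matrix (𝒫(Orb Λ))`,
  `tr (A · fermionPartialTrace φ ρ) = tr (Γ_φ A · ρ)` for all `A ∈ 𝔄_Λ`

— the density matrix of the RESTRICTION of the state `A ↦ tr(ρ A)` to the subalgebra `Γ_φ(𝔄_Λ) ≅ 𝔄_Λ`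
(Bratteli–Robinson I §2.6: a state of a full matrix algebra is `tr(ρ ·)` for a unique density matrix;
Araki–Moriya §4.1 Def. 4.5 / §3: restrictions of a state of the Fermion algebra to the local algebras
`𝔄(I)`). It is the fixed-volume twin of `InfVolFermionState.rdm` (same matrix-unit formula), and the CAR
twin of `spinPartialTrace` (`SpinPartialTrace.lean`). Unlike the spin case, the subalgebra `Γ_φ(𝔄_Λ)` is
NOT a tensor factor of the big matrix algebra in general (Jordan–Wigner strings), so `fermionPartialTrace`
is defined intrinsically by duality and compared with the tensor partial trace only afterwards:

* §1 duality / uniqueness (`trace_mul_fermionPartialTrace`, `eq_fermionPartialTrace_of_forall_trace_mul`),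
  `*`-compatibility, trace and positivity preservation (density matrices go to density matrices),
  functoriality `tr_{ψ ≫ φ} = tr_ψ ∘ tr_φ` (`fermionPartialTrace_trans`), the bijective case
  (`fermionPartialTrace_equiv`: the inverse relabelling `(relabel (Orb.mapEquiv e))⁻¹`, a signed permutation
  conjugation), and the grading: `Θ (tr_φ ρ) = tr_φ (Θ ρ)` (`parityAut_fermionPartialTrace`), so marginals
  of even states are even; odd observables have zero expectation in even states.
* §2 entropy: the von Neumann entropy of a marginal is invariant under relabellings and depends only on
  the RANGE of `φ` (`vonNeumannEntropy_fermionPartialTrace_eq_of_range_eq`) — the entropy of the restriction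
  of a state to `𝔄(I)` is an invariant of the pair (state, `I`), Araki–Moriya §3.1 / §10.
* §3 **Jordan–Wigner dictionary**: under the site-major Jordan–Wigner isomorphism
  `toSpin : 𝔄^{CAR}_Λ ≃ₐ Op Λ 4` (`HubbardJordanWigner`), the fermionic partial trace IS the spin partial
  trace `spinPartialTrace φ (toSpin ρ)` (i) for every `ρ` when `φ` is an order embedding onto an INITIAL
  segment (`toSpin_fermionPartialTrace_of_isLowerSet`, dual to `toSpin_fermionEmbed_of_isLowerSet`), and
  (ii) for EVEN `ρ` when `φ` is an order embedding onto a FINAL segment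
  (`toSpin_fermionPartialTrace_of_isUpperSet_of_even`, dual to `toSpin_fermionEmbed_of_isUpperSet_of_even/odd`:
  on odd observables both sides vanish, the strings below the block being traceless against an even
  state). These are the two cases from which the strong subadditivity of the entropy for even states of
  the CAR algebra (Araki–Moriya Thm. 10.1(?) — SSA for the Fermion algebra, §10) is assembled in the sequel
  file `FermionStrongSubadditivity.lean`; with the entropy identities
  `vonNeumannEntropy_fermionPartialTrace_of_isLowerSet/_of_isUpperSet_of_even`.

Everything is PROVED; the only definition (`fermionPartialTrace`) has a body; no named fact.

## References

* H. Araki, H. Moriya, *Equilibrium statistical mechanics of Fermion lattice systems*, Rev. Math. Phys.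
  15 (2003) 93–198, §4.1 Def. 4.1–4.5 (local algebras, `Θ`, states and their restrictions), §3 and §10
  (entropy of restrictions, strong subadditivity for the Fermion algebra). [ArakiMoriya2003]
* O. Bratteli, D. W. Robinson, *Operator Algebras and Quantum Statistical Mechanics 1*, 2nd ed., §2.6
  (after Def. 2.6.6: `ω(A) = Tr(ρ_α A)`), and *OAQSM 2*, §5.2.2 Thm. 5.2.5 (Jordan–Wigner / Fock
  representation). [BratteliRobinsonI1987] [BratteliRobinsonII1997]
* M. A. Nielsen, I. L. Chuang, *Quantum Computation and Quantum Information* (CUP 2010), §2.4.3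
  eqs. (2.177)–(2.182) (reduced density operator, uniqueness), Thm. 11.8 (unitary invariance of entropy).
  [NielsenChuang2010]

## Tree / Mathlib

Reused: `fermionEmbed` + functoriality/`*`/parity lemmas (`InfVolFermionState`), `relabel`,
`relabelSignMatrix`, `trace_relabel`, `relabel_conjTranspose` (`FermionRelabelling`), `toSpin`, `trace_toSpin`
(`HubbardJordanWigner`), `toSpin_fermionEmbed_of_isLowerSet` (`JordanWignerEmbedding`),
`toSpin_fermionEmbed_of_isUpperSet_of_even/_of_odd`, `productOp_below_eq_diagonal`, `productOp_below_mul_self`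
(`JordanWignerEmbeddingUpper`, `JordanWignerTwist`), `spinPartialTrace` + `eq_spinPartialTrace_of_forall_trace_mul`
(`SpinPartialTrace`), `vonNeumannEntropy_submatrix_equiv`, `vonNeumannEntropy_unitary_conj`
(`InformationTheory/Entropy`). `lean search 'fermionPartialTrace|carPartialTrace|fermion.*rdm'`: only
`InfVolFermionState.rdm` (infinite-volume states, regions of `ℤ^d`), which this generalises to arbitrary
finite volumes and injections.
-/

noncomputable section

namespace Literature.MathematicalPhysics.QuantumLattice

open Matrix Finset HubbardWave0
open scoped ComplexOrder
open Literature.InformationTheory.Entropy (vonNeumannEntropy vonNeumannEntropy_submatrix_equiv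
  vonNeumannEntropy_unitary_conj)

/-! ### §1. The fermionic partial trace along a site injection -/

section PartialTrace

variable {Λ Λ' Λ'' : Type*} [LinearOrder Λ] [Fintype Λ] [LinearOrder Λ'] [Fintype Λ']
  [LinearOrder Λ''] [Fintype Λ'']

/-- **The fermionic partial trace along a site injection `φ : Λ ↪ Λ'`** (reduced density matrix on the
local CAR algebra `𝔄_Λ`, pulled back along `Γ_φ = fermionEmbed φ`): the linear map on Fock-space matrices
with entries `(tr_φ ρ)_{ts} = tr (Γ_φ(|s⟩⟨t|) · ρ)`; equivalently (`trace_mul_fermionPartialTrace`) the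
unique matrix `ρ_Λ` with `tr (A ρ_Λ) = tr (Γ_φ(A) ρ)` for all `A ∈ 𝔄_Λ`, i.e. the density matrix of the
restriction of the state `tr(ρ ·)` to `Γ_φ(𝔄_Λ)`. Araki–Moriya (2003) §4.1 Def. 4.5 (restriction of a
state to `𝔄(I)`); Bratteli–Robinson I §2.6 (density matrix of a state of a matrix algebra).
[cite: ArakiMoriya2003, §4.1 Def. 4.5] -/
def fermionPartialTrace (φ : Λ ↪ Λ') :
    Matrix (Finset (Orb Λ')) (Finset (Orb Λ')) ℂ →ₗ[ℂ] Matrix (Finset (Orb Λ)) (Finset (Orb Λ)) ℂ where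
  toFun ρ := Matrix.of fun t s => (fermionEmbed φ (Matrix.single s t (1 : ℂ)) * ρ).trace
  map_add' ρ τ := by
    ext t s
    simp only [Matrix.of_apply, Matrix.mul_add, Matrix.trace_add, Matrix.add_apply]
  map_smul' c ρ := by
    ext t s
    simp only [Matrix.of_apply, Matrix.mul_smul, Matrix.trace_smul, Matrix.smul_apply, RingHom.id_apply]

/-- Entries of the fermionic partial trace (definitional unfolding). [cite: ArakiMoriya2003, §4.1 Def. 4.5] -/
theorem fermionPartialTrace_apply (φ : Λ ↪ Λ') (ρ : Matrix (Finset (Orb Λ')) (Finset (Orb Λ')) ℂ)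
    (t s : Finset (Orb Λ)) :
    fermionPartialTrace φ ρ t s = (fermionEmbed φ (Matrix.single s t (1 : ℂ)) * ρ).trace := rfl

/-- **Defining duality**: `tr (A · tr_φ ρ) = tr (Γ_φ(A) · ρ)` for every `A ∈ 𝔄_Λ` — `fermionPartialTrace φ`
is the Hilbert–Schmidt adjoint of `fermionEmbed φ`. [cite: NielsenChuang2010, §2.4.3 Box 2.6 eq. (2.180)] -/
theorem trace_mul_fermionPartialTrace (φ : Λ ↪ Λ') (A : Matrix (Finset (Orb Λ)) (Finset (Orb Λ)) ℂ)
    (ρ : Matrix (Finset (Orb Λ')) (Finset (Orb Λ')) ℂ) :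
    (A * fermionPartialTrace φ ρ).trace = (fermionEmbed φ A * ρ).trace := by
  conv_rhs => rw [Matrix.matrix_eq_sum_single A]
  simp only [map_sum, Finset.sum_mul, Matrix.trace_sum]
  rw [Matrix.trace]
  simp only [Matrix.diag_apply, Matrix.mul_apply]
  refine Finset.sum_congr rfl fun s _ => Finset.sum_congr rfl fun t _ => ?_
  have h1 : Matrix.single s t (A s t) = A s t • Matrix.single s t (1 : ℂ) := by
    rw [Matrix.smul_single, smul_eq_mul, mul_one]
  rw [h1, map_smul, Matrix.smul_mul, Matrix.trace_smul, smul_eq_mul, fermionPartialTrace_apply]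

/-- **Uniqueness**: a matrix `R ∈ 𝔄_Λ` reproducing all the expectations `tr (A R) = tr (Γ_φ(A) ρ)` IS the
fermionic partial trace. [cite: NielsenChuang2010, §2.4.3 Box 2.6 eqs. (2.181)–(2.182)] -/
theorem eq_fermionPartialTrace_of_forall_trace_mul (φ : Λ ↪ Λ') (ρ : Matrix (Finset (Orb Λ')) (Finset (Orb Λ')) ℂ)
    {R : Matrix (Finset (Orb Λ)) (Finset (Orb Λ)) ℂ}
    (h : ∀ A : Matrix (Finset (Orb Λ)) (Finset (Orb Λ)) ℂ, (A * R).trace = (fermionEmbed φ A * ρ).trace) :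
    R = fermionPartialTrace φ ρ := by
  ext t s
  rw [fermionPartialTrace_apply, ← h, trace_single_mul, one_mul]

/-- `(tr_φ ρ)ᴴ = tr_φ (ρᴴ)` (`Γ_φ` is a `*`-map). [cite: NielsenChuang2010, §2.4.3] -/
theorem conjTranspose_fermionPartialTrace (φ : Λ ↪ Λ') (ρ : Matrix (Finset (Orb Λ')) (Finset (Orb Λ')) ℂ) :
    (fermionPartialTrace φ ρ)ᴴ = fermionPartialTrace φ ρᴴ := by
  ext t s
  rw [Matrix.conjTranspose_apply, fermionPartialTrace_apply, fermionPartialTrace_apply,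
    ← Matrix.trace_conjTranspose, Matrix.conjTranspose_mul, ← fermionEmbed_conjTranspose,
    Matrix.conjTranspose_single, star_one, Matrix.trace_mul_comm]

/-- The partial trace of a Hermitian matrix is Hermitian. [cite: NielsenChuang2010, §2.4.3] -/
theorem isHermitian_fermionPartialTrace (φ : Λ ↪ Λ') {ρ : Matrix (Finset (Orb Λ')) (Finset (Orb Λ')) ℂ}
    (hρ : ρ.IsHermitian) : (fermionPartialTrace φ ρ).IsHermitian := by
  change (fermionPartialTrace φ ρ)ᴴ = fermionPartialTrace φ ρ
  rw [conjTranspose_fermionPartialTrace, hρ.eq]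

/-- **The partial trace preserves the trace** (`Γ_φ` is unital). [cite: NielsenChuang2010, §2.4.3] -/
theorem trace_fermionPartialTrace (φ : Λ ↪ Λ') (ρ : Matrix (Finset (Orb Λ')) (Finset (Orb Λ')) ℂ) :
    (fermionPartialTrace φ ρ).trace = ρ.trace := by
  have h := trace_mul_fermionPartialTrace φ 1 ρ
  rwa [one_mul, map_one, one_mul] at h

/-- **The partial trace preserves positive semidefiniteness** (density matrices go to density matrices):
`xᴴ (tr_φ ρ) x = tr (Γ_φ(Bᴴ B) ρ) = tr ((Γ_φ B) ρ (Γ_φ B)ᴴ) ≥ 0` with `B = |∅⟩⟨x|`.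
[cite: NielsenChuang2010, §2.4.3] -/
theorem posSemidef_fermionPartialTrace (φ : Λ ↪ Λ') {ρ : Matrix (Finset (Orb Λ')) (Finset (Orb Λ')) ℂ}
    (hρ : ρ.PosSemidef) : (fermionPartialTrace φ ρ).PosSemidef := by
  refine Matrix.PosSemidef.of_dotProduct_mulVec_nonneg (isHermitian_fermionPartialTrace φ hρ.isHermitian)
    fun x => ?_
  set B : Matrix (Finset (Orb Λ)) (Finset (Orb Λ)) ℂ :=
    Matrix.vecMulVec (Pi.single (∅ : Finset (Orb Λ)) 1) (star x) with hB
  have hs : star (Pi.single (∅ : Finset (Orb Λ)) (1 : ℂ) : Finset (Orb Λ) → ℂ) = Pi.single ∅ 1 := by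
    ext j; by_cases h : j = ∅ <;> simp [h]
  have hBB : Bᴴ * B = Matrix.vecMulVec x (star x) := by
    rw [hB, Matrix.conjTranspose_vecMulVec, star_star, hs, Matrix.vecMulVec_mul_vecMulVec, single_dotProduct,
      one_mul, Pi.single_eq_same, one_smul]
  have h1 : star x ⬝ᵥ (fermionPartialTrace φ ρ *ᵥ x) =
      (Matrix.vecMulVec x (star x) * fermionPartialTrace φ ρ).trace := by
    rw [Matrix.trace_mul_comm, Matrix.mul_vecMulVec, Matrix.trace_vecMulVec, dotProduct_comm]
  rw [h1, trace_mul_fermionPartialTrace, ← hBB, map_mul, fermionEmbed_conjTranspose,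
    ← Matrix.trace_mul_cycle (fermionEmbed φ B) ρ (fermionEmbed φ B)ᴴ]
  exact (hρ.mul_mul_conjTranspose_same _).trace_nonneg

/-- **Consistency of marginals / functoriality**: `tr_{ψ ≫ φ} = tr_ψ ∘ tr_φ` (restricting a state to
`𝔄(I) ⊆ 𝔄(J)` directly or through `𝔄(J)` is the same; functoriality `Γ(φ) ∘ Γ(ψ) = Γ(ψ ≫ φ)`).
[cite: ArakiMoriya2003, §4.1 Def. 4.1 (2)] -/
theorem fermionPartialTrace_trans (ψ : Λ ↪ Λ') (φ : Λ' ↪ Λ'') (ρ : Matrix (Finset (Orb Λ'')) (Finset (Orb Λ'')) ℂ) :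
    fermionPartialTrace (ψ.trans φ) ρ = fermionPartialTrace ψ (fermionPartialTrace φ ρ) := by
  symm
  refine eq_fermionPartialTrace_of_forall_trace_mul _ _ fun A => ?_
  rw [trace_mul_fermionPartialTrace, trace_mul_fermionPartialTrace, fermionEmbed_fermionEmbed]

/-- Nothing traced out along the identity: `tr_{id} ρ = ρ`. [cite: NielsenChuang2010, §2.4.3] -/
theorem fermionPartialTrace_refl (ρ : Matrix (Finset (Orb Λ)) (Finset (Orb Λ)) ℂ) :
    fermionPartialTrace (Function.Embedding.refl Λ) ρ = ρ := by
  symm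
  refine eq_fermionPartialTrace_of_forall_trace_mul _ _ fun A => ?_
  rw [fermionEmbed_refl_apply]

/-- **Nothing to trace out along a bijection**: `tr_e ρ = Γ(e)⁻¹ ρ` is the inverse relabelling
(`Γ(e) = relabel (Orb.mapEquiv e)`, conjugation by a signed permutation matrix).
[cite: BratteliRobinsonII1997, §5.2.2 Thm. 5.2.5] -/
theorem fermionPartialTrace_equiv (e : Λ ≃ Λ') (ρ : Matrix (Finset (Orb Λ')) (Finset (Orb Λ')) ℂ) :
    fermionPartialTrace e.toEmbedding ρ = (relabel (Orb.mapEquiv e)).symm ρ := by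
  symm
  refine eq_fermionPartialTrace_of_forall_trace_mul _ _ fun A => ?_
  rw [fermionEmbed_equiv]
  change (A * (relabel (Orb.mapEquiv e)).symm ρ).trace = (relabel (Orb.mapEquiv e) A * ρ).trace
  conv_lhs => rw [← trace_relabel (Orb.mapEquiv e), map_mul, AlgEquiv.apply_symm_apply]

/-! #### The grading -/

/-- `P² = 1` for the fermion parity `P = (-1)^N`. [folklore] -/
private theorem parityOp_mul_parityOp_aux {κ : Type*} [LinearOrder κ] [Fintype κ] :
    (parityOp : Matrix (Finset κ) (Finset κ) ℂ) * parityOp = 1 := by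
  rw [parityOp, Matrix.diagonal_mul_diagonal, ← Matrix.diagonal_one]
  congr 1
  funext s
  rw [← mul_pow]
  norm_num

/-- `tr (A · Θ X) = tr (Θ A · X)`: the even–odd automorphism `Θ = P · P` (`P = (-1)^N`, `P² = 1`) is
symmetric for the trace pairing. [cite: ArakiMoriya2003, §4.1 Def. 4.2] -/
theorem trace_mul_parityAut {κ : Type*} [LinearOrder κ] [Fintype κ] (A X : Matrix (Finset κ) (Finset κ) ℂ) :
    (A * parityAut X).trace = (parityAut A * X).trace := by
  rw [parityAut_apply, parityAut_apply, ← Matrix.mul_assoc, ← Matrix.mul_assoc,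
    Matrix.trace_mul_comm (A * parityOp * X) parityOp, ← Matrix.mul_assoc, ← Matrix.mul_assoc]

/-- **The partial trace commutes with the grading**: `Θ (tr_φ ρ) = tr_φ (Θ ρ)` (since `Γ_φ Θ = Θ Γ_φ`);
in particular marginals of even states are even. [cite: ArakiMoriya2003, §4.1 Def. 4.2–4.5] -/
theorem parityAut_fermionPartialTrace (φ : Λ ↪ Λ') (ρ : Matrix (Finset (Orb Λ')) (Finset (Orb Λ')) ℂ) :
    parityAut (fermionPartialTrace φ ρ) = fermionPartialTrace φ (parityAut ρ) := by
  refine eq_fermionPartialTrace_of_forall_trace_mul _ _ fun A => ?_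
  rw [trace_mul_parityAut, trace_mul_fermionPartialTrace, fermionEmbed_parityAut, ← trace_mul_parityAut]

/-- Marginals of an even state are even. [cite: ArakiMoriya2003, §4.1 Def. 4.5] -/
theorem parityAut_fermionPartialTrace_of_even (φ : Λ ↪ Λ') {ρ : Matrix (Finset (Orb Λ')) (Finset (Orb Λ')) ℂ}
    (hρ : parityAut ρ = ρ) : parityAut (fermionPartialTrace φ ρ) = fermionPartialTrace φ ρ := by
  rw [parityAut_fermionPartialTrace, hρ]

/-- **Odd observables have zero expectation in an even state**: `Θ X = -X`, `Θ ρ = ρ` ⟹ `tr (X ρ) = 0`.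
[cite: ArakiMoriya2003, §4.1 Def. 4.5 (even states)] -/
theorem trace_mul_eq_zero_of_odd_of_even {κ : Type*} [LinearOrder κ] [Fintype κ]
    {X ρ : Matrix (Finset κ) (Finset κ) ℂ} (hX : parityAut X = -X) (hρ : parityAut ρ = ρ) :
    (X * ρ).trace = 0 := by
  have h : (X * ρ).trace = -(X * ρ).trace := by
    conv_lhs => rw [← hρ, trace_mul_parityAut, hX, Matrix.neg_mul, Matrix.trace_neg]
  linear_combination h / 2

end PartialTrace

/-! ### §2. Entropy of marginals: invariance under relabellings; dependence on the range only -/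

section Entropy

variable {Λ Λ' Λ₁ Λ₂ : Type*} [LinearOrder Λ] [Fintype Λ] [LinearOrder Λ'] [Fintype Λ']
  [LinearOrder Λ₁] [Fintype Λ₁] [LinearOrder Λ₂] [Fintype Λ₂]

/-- The signed permutation conjugation `relabel e` (a `*`-isomorphism) preserves Hermiticity.
[cite: BratteliRobinsonII1997, §5.2.2 Thm. 5.2.5] -/
theorem isHermitian_relabel {ι ι' : Type*} [LinearOrder ι] [LinearOrder ι'] [Fintype ι] [Fintype ι']
    (e : ι ≃ ι') {a : Matrix (Finset ι) (Finset ι) ℂ} (ha : a.IsHermitian) : (relabel e a).IsHermitian := by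
  change (relabel e a)ᴴ = relabel e a
  rw [← relabel_conjTranspose, ha.eq]

/-- The inverse relabelling (a `*`-isomorphism) preserves Hermiticity.
[cite: BratteliRobinsonII1997, §5.2.2 Thm. 5.2.5] -/
theorem isHermitian_relabel_symm {ι ι' : Type*} [LinearOrder ι] [LinearOrder ι'] [Fintype ι] [Fintype ι']
    (e : ι ≃ ι') {a : Matrix (Finset ι') (Finset ι') ℂ} (ha : a.IsHermitian) :
    ((relabel e).symm a).IsHermitian := by
  have h : relabel e ((relabel e).symm a)ᴴ = relabel e ((relabel e).symm a) := by
    rw [relabel_conjTranspose, AlgEquiv.apply_symm_apply, ha.eq]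
  exact (relabel e).injective h

/-- **The entropy is invariant under relabellings of the orbitals**: `S(Γ(e) a Γ(e)⁻¹) = S(a)` — `relabel e`
is conjugation by a signed permutation unitary ("the entropy is determined completely by the
eigenvalues"). [cite: NielsenChuang2010, Theorem 11.8 (3) (proof) p.513] -/
theorem vonNeumannEntropy_relabel {ι ι' : Type*} [LinearOrder ι] [LinearOrder ι'] [Fintype ι] [Fintype ι']
    (e : ι ≃ ι') {a : Matrix (Finset ι) (Finset ι) ℂ} (ha : a.IsHermitian) :
    vonNeumannEntropy (relabel e a) = vonNeumannEntropy a := by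
  have hD : (relabelSignMatrix e)ᴴ = relabelSignMatrix e := by
    rw [relabelSignMatrix, Matrix.diagonal_conjTranspose]
    congr 1
    funext s
    exact star_relabelSign e s
  have hU : relabelSignMatrix e ∈ Matrix.unitaryGroup (Finset ι) ℂ := by
    rw [Matrix.mem_unitaryGroup_iff, Matrix.star_eq_conjTranspose, hD, relabelSignMatrix_mul_self]
  have hDaD : (relabelSignMatrix e * a * (relabelSignMatrix e)ᴴ).IsHermitian :=
    Matrix.isHermitian_mul_mul_conjTranspose _ ha
  have h1 : relabel e a = (relabelSignMatrix e * a * (relabelSignMatrix e)ᴴ).submatrix e.finsetCongr.symm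
      e.finsetCongr.symm := by
    rw [hD]
    ext s' t'
    obtain ⟨s, rfl⟩ := e.finsetCongr.surjective s'
    obtain ⟨t, rfl⟩ := e.finsetCongr.surjective t'
    rw [relabel_apply_finsetCongr, Matrix.submatrix_apply, Equiv.symm_apply_apply, Equiv.symm_apply_apply,
      relabelSignMatrix, Matrix.mul_diagonal, Matrix.diagonal_mul]
  rw [h1, vonNeumannEntropy_submatrix_equiv hDaD]
  exact vonNeumannEntropy_unitary_conj hU ha

/-- The entropy is invariant under the inverse relabelling. [cite: NielsenChuang2010, Theorem 11.8 (3) (proof) p.513] -/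
theorem vonNeumannEntropy_relabel_symm {ι ι' : Type*} [LinearOrder ι] [LinearOrder ι'] [Fintype ι] [Fintype ι']
    (e : ι ≃ ι') {a : Matrix (Finset ι') (Finset ι') ℂ} (ha : a.IsHermitian) :
    vonNeumannEntropy ((relabel e).symm a) = vonNeumannEntropy a := by
  conv_rhs => rw [← (relabel e).apply_symm_apply a]
  rw [vonNeumannEntropy_relabel e (isHermitian_relabel_symm e ha)]

/-- **Marginal along a bijection = same entropy**: `S(tr_e ρ) = S(ρ)` for a site bijection `e`.
[cite: ArakiMoriya2003, §3.1 (entropy of a state of a finite-dimensional algebra)] -/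
theorem vonNeumannEntropy_fermionPartialTrace_equiv (e : Λ ≃ Λ') {ρ : Matrix (Finset (Orb Λ')) (Finset (Orb Λ')) ℂ}
    (hρ : ρ.IsHermitian) : vonNeumannEntropy (fermionPartialTrace e.toEmbedding ρ) = vonNeumannEntropy ρ := by
  rw [fermionPartialTrace_equiv, vonNeumannEntropy_relabel_symm _ hρ]

omit [LinearOrder Λ'] [Fintype Λ'] [LinearOrder Λ₁] [Fintype Λ₁] [LinearOrder Λ₂] [Fintype Λ₂] in
/-- Two injections with the same range differ by a bijection of their sources. [folklore] -/
private theorem exists_equiv_trans_eq_of_range_eq (φ₁ : Λ₁ ↪ Λ') (φ₂ : Λ₂ ↪ Λ') (h : Set.range φ₁ = Set.range φ₂) :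
    ∃ e : Λ₁ ≃ Λ₂, φ₁ = e.toEmbedding.trans φ₂ := by
  refine ⟨(Equiv.ofInjective φ₁ φ₁.injective).trans
    ((Equiv.setCongr h).trans (Equiv.ofInjective φ₂ φ₂.injective).symm), ?_⟩
  refine DFunLike.ext _ _ fun x => ?_
  rw [Function.Embedding.trans_apply, Equiv.coe_toEmbedding, Equiv.trans_apply, Equiv.trans_apply,
    Equiv.apply_ofInjective_symm φ₂.injective]
  rfl

/-- **The entropy of a marginal depends only on the range of the injection** — the entropy of the
restriction of a state to `𝔄(I)` is an invariant of the state and of the region `I = im φ`, not of the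
labelling of `I`. [cite: ArakiMoriya2003, §3.1 and §10] -/
theorem vonNeumannEntropy_fermionPartialTrace_eq_of_range_eq (φ₁ : Λ₁ ↪ Λ') (φ₂ : Λ₂ ↪ Λ')
    (h : Set.range φ₁ = Set.range φ₂) {ρ : Matrix (Finset (Orb Λ')) (Finset (Orb Λ')) ℂ} (hρ : ρ.IsHermitian) :
    vonNeumannEntropy (fermionPartialTrace φ₁ ρ) = vonNeumannEntropy (fermionPartialTrace φ₂ ρ) := by
  obtain ⟨e, he⟩ := exists_equiv_trans_eq_of_range_eq φ₁ φ₂ h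
  rw [he, fermionPartialTrace_trans,
    vonNeumannEntropy_fermionPartialTrace_equiv e (isHermitian_fermionPartialTrace φ₂ hρ)]

/-- The Jordan–Wigner reindexing `toSpin` preserves the entropy. [cite: NielsenChuang2010, Theorem 11.8 (3) (proof) p.513] -/
theorem vonNeumannEntropy_toSpin {ρ : Matrix (Finset (Orb Λ)) (Finset (Orb Λ)) ℂ} (hρ : ρ.IsHermitian) :
    vonNeumannEntropy (JordanWigner.toSpin ρ) = vonNeumannEntropy ρ := by
  have h : JordanWigner.toSpin ρ = ρ.submatrix JordanWigner.configEquiv JordanWigner.configEquiv := by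
    ext k k'
    simp
  rw [h]
  exact vonNeumannEntropy_submatrix_equiv hρ _

end Entropy

/-! ### §3. The Jordan–Wigner dictionary: fermionic versus spin partial trace -/

section Dictionary

open JordanWigner

variable {Λ₁ Λ₂ : Type*} [LinearOrder Λ₁] [Fintype Λ₁] [LinearOrder Λ₂] [Fintype Λ₂]

/-- **Initial segments: the fermionic partial trace IS the spin partial trace.** For an order embedding
`φ` whose image is a lower set, `toSpin (tr^{CAR}_φ ρ) = tr^{spin}_φ (toSpin ρ)` for EVERY `ρ` — dual to
`toSpin ∘ Γ^{CAR}_φ = Γ^{spin}_φ ∘ toSpin` (no Jordan–Wigner string enters an initial block).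
[cite: BratteliRobinsonII1997, §5.2.2 Thm. 5.2.5] -/
theorem toSpin_fermionPartialTrace_of_isLowerSet (φ : Λ₁ ↪o Λ₂) (hφ : IsLowerSet (Set.range φ))
    (ρ : Matrix (Finset (Orb Λ₂)) (Finset (Orb Λ₂)) ℂ) :
    toSpin (fermionPartialTrace φ.toEmbedding ρ) = spinPartialTrace φ.toEmbedding (toSpin ρ) := by
  refine eq_spinPartialTrace_of_forall_trace_mul _ _ fun X => ?_
  obtain ⟨A, rfl⟩ := toSpin.surjective X
  rw [← map_mul, trace_toSpin, trace_mul_fermionPartialTrace, ← toSpin_fermionEmbed_of_isLowerSet φ hφ,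
    ← map_mul, trace_toSpin]

/-- Entropy form of the initial-segment dictionary: `S(tr^{CAR}_φ ρ) = S(tr^{spin}_φ (toSpin ρ))`.
[cite: BratteliRobinsonII1997, §5.2.2 Thm. 5.2.5] -/
theorem vonNeumannEntropy_fermionPartialTrace_of_isLowerSet (φ : Λ₁ ↪o Λ₂) (hφ : IsLowerSet (Set.range φ))
    {ρ : Matrix (Finset (Orb Λ₂)) (Finset (Orb Λ₂)) ℂ} (hρ : ρ.IsHermitian) :
    vonNeumannEntropy (fermionPartialTrace φ.toEmbedding ρ) =
      vonNeumannEntropy (spinPartialTrace φ.toEmbedding (toSpin ρ)) := by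
  rw [← toSpin_fermionPartialTrace_of_isLowerSet φ hφ,
    vonNeumannEntropy_toSpin (isHermitian_fermionPartialTrace _ hρ)]

/-- The string below a final segment, `P_below = ⨂_{z ∉ im φ} F_z`, is traceless against the Jordan–Wigner
image of an ODD matrix: `tr (P_below · toSpin Y) = 0` if `Θ Y = -Y` (both `P_below` and `toSpin((-1)^N)`
are diagonal, hence commute, and `toSpin (Θ Y) = (⨂F) (toSpin Y) (⨂F)`). [cite: EsslerEtAl2005, §12.3.4 eq. (12.198)] -/
theorem trace_productOp_below_mul_toSpin_eq_zero_of_odd (φ : Λ₁ ↪o Λ₂) {Y : Matrix (Finset (Orb Λ₂)) (Finset (Orb Λ₂)) ℂ}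
    (hY : parityAut Y = -Y) :
    (productOp (fun z : Λ₂ => if z ∈ rangeSites φ.toEmbedding then (1 : Matrix (Fin 4) (Fin 4) ℂ) else siteParity) *
      toSpin Y).trace = 0 := by
  set Pb := productOp (fun z : Λ₂ => if z ∈ rangeSites φ.toEmbedding then (1 : Matrix (Fin 4) (Fin 4) ℂ)
    else siteParity) with hPb
  set F : Op Λ₂ 4 := productOp fun _ : Λ₂ => siteParity with hF
  have hFF : F * F = 1 := productOp_siteParity_mul_self
  have hcomm : Pb * F = F * Pb := by
    have h1 : (fun _ : Λ₂ => siteParity) = fun _ : Λ₂ => diagonal fun a : Fin 4 => (-1 : ℂ) ^ siteCharge a := by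
      funext x; rfl
    rw [hPb, hF, productOp_below_eq_diagonal, h1, productOp_diagonal, Matrix.diagonal_mul_diagonal,
      Matrix.diagonal_mul_diagonal]
    congr 1
    funext k
    exact mul_comm _ _
  have hYF : toSpin Y = -(F * toSpin Y * F) := by
    rw [hF, ← toSpin_parityAut, hY, map_neg, neg_neg]
  have h : (Pb * toSpin Y).trace = -(Pb * toSpin Y).trace := by
    conv_lhs => rw [hYF, Matrix.mul_neg, Matrix.trace_neg, ← Matrix.mul_assoc, ← Matrix.mul_assoc, hcomm,
      Matrix.trace_mul_cycle, ← Matrix.mul_assoc, hFF, Matrix.one_mul]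
  linear_combination h / 2

/-- **Final segments, even states: the fermionic partial trace IS the spin partial trace.** For an order
embedding `φ` whose image is an upper set and an EVEN `ρ` (`Θ ρ = ρ`),
`toSpin (tr^{CAR}_φ ρ) = tr^{spin}_φ (toSpin ρ)`: on even observables `toSpin ∘ Γ^{CAR}_φ = Γ^{spin}_φ ∘ toSpin`,
on odd ones both pairings vanish (the even state kills odd elements; the string `P_below` is traceless
against the odd matrix `Γ_φ(A₋) ρ`). This is the matrix form of "the even part of `𝔄(I)` is a tensor factor"
behind the SSA of CAR entropies. [cite: ArakiMoriya2003, §4.1–4.2 and §10] -/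
theorem toSpin_fermionPartialTrace_of_isUpperSet_of_even (φ : Λ₁ ↪o Λ₂) (hφ : IsUpperSet (Set.range φ))
    {ρ : Matrix (Finset (Orb Λ₂)) (Finset (Orb Λ₂)) ℂ} (hρ : parityAut ρ = ρ) :
    toSpin (fermionPartialTrace φ.toEmbedding ρ) = spinPartialTrace φ.toEmbedding (toSpin ρ) := by
  refine eq_spinPartialTrace_of_forall_trace_mul _ _ fun X => ?_
  obtain ⟨A, rfl⟩ := toSpin.surjective X
  -- even / odd decomposition of the test observable
  set Ap : Matrix (Finset (Orb Λ₁)) (Finset (Orb Λ₁)) ℂ := (1 / 2 : ℂ) • (A + parityAut A) with hAp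
  set Am : Matrix (Finset (Orb Λ₁)) (Finset (Orb Λ₁)) ℂ := (1 / 2 : ℂ) • (A - parityAut A) with hAm
  have hsplit : A = Ap + Am := by
    rw [hAp, hAm, ← smul_add]
    have : A + parityAut A + (A - parityAut A) = (2 : ℂ) • A := by rw [two_smul]; abel
    rw [this, smul_smul]; norm_num
  have hΘΘ : parityAut (parityAut A) = A := parityAut_parityAut A
  have hApe : parityAut Ap = Ap := by
    rw [hAp, map_smul, map_add, hΘΘ, add_comm]
  have hAmo : parityAut Am = -Am := by
    rw [hAm, map_smul, map_sub, hΘΘ, ← smul_neg, neg_sub]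
  -- odd part: both sides vanish
  have hoddC : (fermionEmbed φ.toEmbedding Am * ρ).trace = 0 :=
    trace_mul_eq_zero_of_odd_of_even (by rw [← fermionEmbed_parityAut, hAmo, map_neg]) hρ
  have hoddS : (spinEmbed φ.toEmbedding (toSpin Am) * toSpin ρ).trace = 0 := by
    have hodd' : parityAut (fermionEmbed φ.toEmbedding Am * ρ) = -(fermionEmbed φ.toEmbedding Am * ρ) := by
      rw [map_mul, ← fermionEmbed_parityAut, hAmo, hρ, map_neg, Matrix.neg_mul]
    have h1 : spinEmbed φ.toEmbedding (toSpin Am) =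
        productOp (fun z : Λ₂ => if z ∈ rangeSites φ.toEmbedding then (1 : Matrix (Fin 4) (Fin 4) ℂ)
          else siteParity) * toSpin (fermionEmbed φ.toEmbedding Am) := by
      rw [toSpin_fermionEmbed_of_isUpperSet_of_odd φ hφ hAmo, ← Matrix.mul_assoc, productOp_below_mul_self,
        Matrix.one_mul]
    rw [h1, Matrix.mul_assoc, ← map_mul]
    exact trace_productOp_below_mul_toSpin_eq_zero_of_odd φ hodd'
  rw [hsplit, map_add, map_add, Matrix.add_mul, Matrix.add_mul, Matrix.trace_add, Matrix.trace_add,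
    ← map_mul, trace_toSpin, trace_mul_fermionPartialTrace, ← map_mul, trace_toSpin,
    trace_mul_fermionPartialTrace, hoddC, hoddS, ← toSpin_fermionEmbed_of_isUpperSet_of_even φ hφ hApe,
    ← map_mul, trace_toSpin]

/-- Entropy form of the final-segment dictionary for even states. [cite: ArakiMoriya2003, §10] -/
theorem vonNeumannEntropy_fermionPartialTrace_of_isUpperSet_of_even (φ : Λ₁ ↪o Λ₂) (hφ : IsUpperSet (Set.range φ))
    {ρ : Matrix (Finset (Orb Λ₂)) (Finset (Orb Λ₂)) ℂ} (hρ : parityAut ρ = ρ) (hρh : ρ.IsHermitian) :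
    vonNeumannEntropy (fermionPartialTrace φ.toEmbedding ρ) =
      vonNeumannEntropy (spinPartialTrace φ.toEmbedding (toSpin ρ)) := by
  rw [← toSpin_fermionPartialTrace_of_isUpperSet_of_even φ hφ hρ,
    vonNeumannEntropy_toSpin (isHermitian_fermionPartialTrace _ hρh)]

end Dictionary

end Literature.MathematicalPhysics.QuantumLattice

end
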